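import Summits.CriticalPhenomena.PercolationContinuityZ3.Theorems.PercNearOneGluingNoHeavyLowerTailTformGluedWitness
import HarnessLib

/-!
# `NoHeavyLowerTail` (stmt-CriticalPhenomena-4575) — the crux reduced to the PRIORITY-CHAIN witness inequality
# ('a T-witness of every member is a T-witness of the first-attached-member observer'), no gluing in the hypothesis

Support file (prover `prim-hp-5`, hull-port cell, T-form calculus, gen 6; `--supports stmt-CriticalPhenomena-4575`).
No definitions, no named facts, no sorries.  Vertices `Fin n` (naturally ordered), `μ = prodBernoulli u`, relays `A`, level `j`,
`N_v = |{a ∈ A : v ↔ a}|`, `N_B = |{a ∈ A : ∃ y ∈ B, y ↔ a}|`, `M_v = {1 ≤ N_v ≤ j}`, `Z_v = {N_v = 0}`, `x ≁ B = {∀ y ∈ B, x ↮ y}`.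

`Theorems.noHeavyLowerTail_of_gluedWitness₂` (file `…TformGluedWitness`) reduces the crux to GLUE-ADM: a relay that is a T-witness of
every member of a non-relay set `B` (`2 ≤ |B|`) is a T-witness of the GLUED observer `B`:
`μ(x ≁ B, 1 ≤ N_B ≤ j) + μ(N_B = 0, N_c ≤ j) ≤ μ(x ≁ B, N_x ≤ j)`.  Pointwise, on `{x ≁ B, 1 ≤ N_B ≤ j}` the FIRST attached
member `y₀` of `B` (in the order of `Fin n`) satisfies `1 ≤ N_{y₀} ≤ N_B ≤ j`, i.e. the configuration lies in the chain event
`E_{y₀} = {x ≁ B} ∩ ⋂_{y' < y₀, y' ∈ B} Z_{y'} ∩ M_{y₀}`; hence GLUE-ADM follows from the **priority-chain inequality**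
    `Σ_{y ∈ B} μ(E_y) + μ(N_B = 0, N_c ≤ j) ≤ μ(x ≁ B, N_x ≤ j)`                                                  (PC)
— "`x` is a T-witness of the PRIORITY observer of `B`" (read the first attached member's cluster; fall back to `c` if none) — whose
hypothesis-side events involve no gluing at all.  This file proves

* `gluedSet_of_priorityChain` — (PC) at `c` ⟹ the GLUE-ADM inequality at `c` (any `B`, any vertex `x`; pure inclusion + union bound);
* `noHeavyLowerTail_of_priorityChains` — **the crux follows from**: for every finite weighted graph, relays `A`, non-relay `B` with
  `2 ≤ |B|`, `x ∈ A` a T-witness of every `y ∈ B` (all `c`), and every `c ∈ A`, the priority-chain inequality (PC) holds.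

Census for the new hypothesis (seat, exact; memo run/shared/lean/prim/prim-hp-5/OBSERVER-SET.md §12–13): |B| = 2 — 0 violations for
BOTH orders in 4.3k random admissible cases (n ≤ 8), 120 SA climbs, and all 32 640 supports at n = 6 (A = 3 relays, 1 Steiner vertex)
× 8 weight draws (≈ 0.8M (x, order) cases, incl. the adm(y)-only cases); |B| = 3 — 0/3.6k per order.  The two halves into which (PC) splits
for |B| = 2 (COND-CIL, RED0; file `…TformPairTrichotomy`) are each FALSE (ttrl2 exhaustive), so (PC) is to be attacked whole.
-/

noncomputable section

namespace Summit.CriticalPhenomena.PercolationContinuityZ3.Theorems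

open MeasureTheory Set Literature.Probability.LatticeModels Literature.Probability.Percolation
open scoped Classical BigOperators

/-- **The glued-set T-witness inequality from the priority chain** (pointwise).  For vertices `Fin n`, any `x`, `c`, finset `B`,
level `j`: if `Σ_{y ∈ B} μ(x ≁ B, Z_{y'} ∀ y' ∈ B with y' < y, 1 ≤ N_y ≤ j) + μ(N_B = 0, N_c ≤ j) ≤ μ(x ≁ B, N_x ≤ j)` then
`μ(x ≁ B, 1 ≤ N_B ≤ j) + μ(N_B = 0, N_c ≤ j) ≤ μ(x ≁ B, N_x ≤ j)`: on `{x ≁ B, 1 ≤ N_B ≤ j}` the `Fin n`-least attached member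
`y₀` of `B` has `1 ≤ N_{y₀} ≤ N_B ≤ j` and all earlier members unattached. [cite: KozmaNitzan2024, §3.2 (pp. 12–14: decomposition by the first set met)] -/
theorem gluedSet_of_priorityChain (n : ℕ) (u : Sym2 (Fin n) → unitInterval) (A B : Finset (Fin n)) (x c : Fin n) (j : ℕ)
    (hPC : ∑ y ∈ B, (prodBernoulli u).real {ω : BondConfig (Fin n) |
              (∀ y' ∈ B, ω ∉ openConn x y') ∧
                (∀ y' ∈ B, y' < y → ¬ 1 ≤ (A.filter fun z => ω ∈ openConn y' z).card) ∧
                1 ≤ (A.filter fun z => ω ∈ openConn y z).card ∧ (A.filter fun z => ω ∈ openConn y z).card ≤ j} +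
          (prodBernoulli u).real {ω : BondConfig (Fin n) |
            ¬ 1 ≤ (A.filter fun z => ∃ y ∈ B, ω ∈ openConn y z).card ∧
              (A.filter fun z => ω ∈ openConn c z).card ≤ j} ≤
        (prodBernoulli u).real {ω : BondConfig (Fin n) |
            (∀ y ∈ B, ω ∉ openConn x y) ∧ (A.filter fun z => ω ∈ openConn x z).card ≤ j}) :
    (prodBernoulli u).real {ω : BondConfig (Fin n) |
        (∀ y ∈ B, ω ∉ openConn x y) ∧
          1 ≤ (A.filter fun z => ∃ y ∈ B, ω ∈ openConn y z).card ∧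
          (A.filter fun z => ∃ y ∈ B, ω ∈ openConn y z).card ≤ j} +
      (prodBernoulli u).real {ω : BondConfig (Fin n) |
        ¬ 1 ≤ (A.filter fun z => ∃ y ∈ B, ω ∈ openConn y z).card ∧
          (A.filter fun z => ω ∈ openConn c z).card ≤ j} ≤
    (prodBernoulli u).real {ω : BondConfig (Fin n) |
        (∀ y ∈ B, ω ∉ openConn x y) ∧ (A.filter fun z => ω ∈ openConn x z).card ≤ j} := by
  classical
  set μ := prodBernoulli u with hμ
  haveI : IsProbabilityMeasure μ := by rw [hμ]; infer_instance
  -- the chain events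
  set E : Fin n → Set (BondConfig (Fin n)) := fun y => {ω : BondConfig (Fin n) |
      (∀ y' ∈ B, ω ∉ openConn x y') ∧
        (∀ y' ∈ B, y' < y → ¬ 1 ≤ (A.filter fun z => ω ∈ openConn y' z).card) ∧
        1 ≤ (A.filter fun z => ω ∈ openConn y z).card ∧ (A.filter fun z => ω ∈ openConn y z).card ≤ j} with hE
  set S : Set (BondConfig (Fin n)) := {ω : BondConfig (Fin n) |
      (∀ y ∈ B, ω ∉ openConn x y) ∧
        1 ≤ (A.filter fun z => ∃ y ∈ B, ω ∈ openConn y z).card ∧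
        (A.filter fun z => ∃ y ∈ B, ω ∈ openConn y z).card ≤ j} with hS
  -- pointwise: `S ⊆ ⋃_{y ∈ B} E y` (take the least attached member)
  have hsub : S ⊆ ⋃ y ∈ B, E y := by
    intro ω hω
    rcases hω with ⟨hxB, hB1, hBj⟩
    -- some member is attached
    have hatt : ∃ y ∈ B, 1 ≤ (A.filter fun z => ω ∈ openConn y z).card := by
      by_contra hnone
      have hempty : (A.filter fun z => ∃ y ∈ B, ω ∈ openConn y z) = ∅ := by
        refine Finset.filter_eq_empty_iff.2 fun z hz hex => ?_
        obtain ⟨y, hy, hyz⟩ := hex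
        exact hnone ⟨y, hy, Finset.card_pos.2 ⟨z, Finset.mem_filter.2 ⟨hz, hyz⟩⟩⟩
      rw [hempty, Finset.card_empty] at hB1
      omega
    -- the least attached member
    obtain ⟨y₀, hy₀mem, hy₀min⟩ := Finset.exists_min_image
      (B.filter fun y => 1 ≤ (A.filter fun z => ω ∈ openConn y z).card) id
      (by obtain ⟨y, hy, h⟩ := hatt; exact ⟨y, Finset.mem_filter.2 ⟨hy, h⟩⟩)
    have hy₀ := Finset.mem_filter.1 hy₀mem
    refine mem_iUnion₂.2 ⟨y₀, hy₀.1, ?_⟩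
    refine ⟨hxB, fun y' hy' hlt => fun hatt' => ?_, hy₀.2, ?_⟩
    · -- an earlier attached member contradicts minimality
      exact absurd (hy₀min y' (Finset.mem_filter.2 ⟨hy', hatt'⟩) : y₀ ≤ y') (not_le.2 hlt)
    · -- `N_{y₀} ≤ N_B ≤ j`
      refine le_trans (Finset.card_le_card fun z hz => ?_) hBj
      rw [Finset.mem_filter] at hz ⊢
      exact ⟨hz.1, y₀, hy₀.1, hz.2⟩
  have hle : μ.real S ≤ ∑ y ∈ B, μ.real (E y) :=
    (measureReal_mono hsub (measure_ne_top _ _)).trans (measureReal_biUnion_finset_le B E)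
  have hPC' : ∑ y ∈ B, μ.real (E y) +
      μ.real {ω : BondConfig (Fin n) | ¬ 1 ≤ (A.filter fun z => ∃ y ∈ B, ω ∈ openConn y z).card ∧
        (A.filter fun z => ω ∈ openConn c z).card ≤ j} ≤
      μ.real {ω : BondConfig (Fin n) | (∀ y ∈ B, ω ∉ openConn x y) ∧ (A.filter fun z => ω ∈ openConn x z).card ≤ j} := hPC
  linarith [hle, hPC']

/-- **The crux `NoHeavyLowerTail` follows from the PRIORITY-CHAIN witness inequality.**  If for every finite weighted graph on `Fin n`,
relays `A`, non-relay finset `B` with `2 ≤ |B|`, relay `x ∈ A` that is a T-witness of every member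
(`μ(1 ≤ N_y ≤ j) + μ(N_c ≤ j) ≤ μ(N_c ≤ j, 1 ≤ N_y) + μ(N_x ≤ j)` for all `y ∈ B`, `c ∈ A`) and every `c ∈ A` the priority-chain
inequality `Σ_{y∈B} μ(x ≁ B, Z_{y'} (y' ∈ B, y' < y), 1 ≤ N_y ≤ j) + μ(N_B = 0, N_c ≤ j) ≤ μ(x ≁ B, N_x ≤ j)` holds, then
`NoHeavyLowerTail`.  (`gluedSet_of_priorityChain` turns the chain inequality into the hypothesis `hGlue` of
`Theorems.noHeavyLowerTail_of_gluedWitness₂`.) [cite: KozmaNitzan2024, §3.2 (pp. 12–14)] -/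
theorem noHeavyLowerTail_of_priorityChains
    (hPC : ∀ (n : ℕ) (u : Sym2 (Fin n) → unitInterval) (A B : Finset (Fin n)) (x : Fin n) (j : ℕ),
      x ∈ A → (∀ y ∈ B, y ∉ A) → 2 ≤ B.card →
      (∀ y ∈ B, ∀ c ∈ A,
        (prodBernoulli u).real {ω : BondConfig (Fin n) |
            1 ≤ (A.filter fun z => ω ∈ openConn y z).card ∧ (A.filter fun z => ω ∈ openConn y z).card ≤ j} +
          (prodBernoulli u).real {ω : BondConfig (Fin n) | (A.filter fun z => ω ∈ openConn c z).card ≤ j} ≤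
        (prodBernoulli u).real {ω : BondConfig (Fin n) |
            (A.filter fun z => ω ∈ openConn c z).card ≤ j ∧ 1 ≤ (A.filter fun z => ω ∈ openConn y z).card} +
          (prodBernoulli u).real {ω : BondConfig (Fin n) | (A.filter fun z => ω ∈ openConn x z).card ≤ j}) →
      ∀ c ∈ A,
        ∑ y ∈ B, (prodBernoulli u).real {ω : BondConfig (Fin n) |
            (∀ y' ∈ B, ω ∉ openConn x y') ∧
              (∀ y' ∈ B, y' < y → ¬ 1 ≤ (A.filter fun z => ω ∈ openConn y' z).card) ∧
              1 ≤ (A.filter fun z => ω ∈ openConn y z).card ∧ (A.filter fun z => ω ∈ openConn y z).card ≤ j} +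
          (prodBernoulli u).real {ω : BondConfig (Fin n) |
            ¬ 1 ≤ (A.filter fun z => ∃ y ∈ B, ω ∈ openConn y z).card ∧
              (A.filter fun z => ω ∈ openConn c z).card ≤ j} ≤
        (prodBernoulli u).real {ω : BondConfig (Fin n) |
            (∀ y ∈ B, ω ∉ openConn x y) ∧ (A.filter fun z => ω ∈ openConn x z).card ≤ j}) :
    Summit.CriticalPhenomena.PercolationContinuityZ3.Theses.PercNearOneGluing.NoHeavyLowerTail :=
  noHeavyLowerTail_of_gluedWitness₂ fun n u A B x j hx hB hcard hW c hc =>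
    gluedSet_of_priorityChain n u A B x c j (hPC n u A B x j hx hB hcard hW c hc)

end Summit.CriticalPhenomena.PercolationContinuityZ3.Theorems

end
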